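import Literature.LinearAlgebra.BaseChange.AutComplexFixedDescent
import Mathlib.LinearAlgebra.Dimension.Finrank
import Mathlib.LinearAlgebra.TensorProduct.Tower
import HarnessLib

/-!
# Semilinear transport of ranks along `Aut(ℂ)`: conjugate endomorphisms of `ℂ ⊗_ℚ V` have ranges of the same dimension

Topic `LinearAlgebra/BaseChange`; namespace `Literature.LinearAlgebra.BaseChange`.  THEOREMS ONLY (Mathlib + ★ (G3) `AutComplexFixedDescent`;
no definition, no named fact, no instance, no `sorry`).  Cell hodgecm-mathlib, d6 line, «(B-orbit)» (A-plan2 (g11) 2026-08-29T22:09:31Z GO):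
the SOURCE of «the block dimensions `d_σ = dim_ℂ e_σ(ℂ ⊗ V)` are constant on an `Aut(ℂ/ℚ)`-orbit» in the dimension identity (ii)
`[Z:ℚ]·dim H = (dim V)²` (★ `CauchySchwarzOnesEqualityCase` (a); ★ (G4) `AutComplexCentralIdempotentOrbit` for the transitivity of the orbit).

MATHEMATICS ([Milne2017] Ch. 4 §i, Prop. 4.31 / Cor. 4.34, the `Aut(k′/k)`-equivariance of base change; [BourbakiAlgebraI1989] Ch. II §8
no. 7 (dimension is invariant under semilinear bijections)): if `T : W → W` is an additive bijection which is τ-SEMILINEAR (`T(z w) = τ(z) T(w)`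
for a field automorphism `τ`) and `T ∘ f = g ∘ T` for `K`-linear `f, g`, then `T` restricts to a τ-semilinear bijection `range f ≃ range g`,
so `rank (range f) = rank (range g)` (Mathlib `rank_eq_of_equiv_equiv`, the tree's device for ι-semilinear comparisons, ★
`OmegaHomBettiComparisonRank`).  On `W = ℂ ⊗_ℚ V` the maps `T_τ = τ ⊗ 1` (`LinearMap.rTensor`, ★ (G3) `rTensor_aut_tmul`) are such
bijections, commuting with every base-changed rational endomorphism `h ⊗ 1` and twisting complex scalars by `τ`; hence an element
`x = Σ z_k ⊗ h_k` of `ℂ ⊗_ℚ End_ℚ V` acting by `Σ z_k (h_k ⊗ 1)` is `T_τ`-conjugate to the action of `(τ ⊗ id) x`, and a TRANSITIVE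
`Aut(ℂ)`-orbit of such elements (★ (G4)) has ranges of one common dimension.

CONTENT: §1 `rank_range_eq_of_semiconj` / `finrank_range_eq_of_semiconj` (any semiring `K`, any `τ : K ≃+* K`), `rank_range_eq_of_forall_exists_semiconj`
(constancy on a transitive family); §2 `W = ℂ ⊗_ℚ V`: `rTensor_aut_smul` (τ-semilinearity), `rTensor_aut_rTensor_aut_symm` / `…_symm_…`
(inverse), `rTensor_aut_bijective`, `rTensor_aut_baseChange` (commutes with `h ⊗ 1`), **`finrank_range_eq_of_rTensor_aut_conj`**.
HC_CM is proved only modulo the 7 printed citations until rung 0 closes; nothing here moves a book.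

## References
* [Milne2017] J. S. Milne, *Algebraic Groups*, CUP (2017), Ch. 4 §i, Prop. 4.31 and Cor. 4.34.
* [BourbakiAlgebraI1989] N. Bourbaki, *Algebra I, Chapters 1–3*, Springer (1989), Ch. II §1 no. 13 (semi-linear maps) and §7 no. 2 (dimension of vector spaces).
-/

set_option autoImplicit false

noncomputable section

open scoped TensorProduct

namespace Literature.LinearAlgebra.BaseChange

/-! ## §1 Ranges of semilinearly conjugate endomorphisms have the same rank -/

section Semiconj

variable {K : Type*} [Semiring K] {W : Type*} [AddCommMonoid W] [Module K W]

/-- **Semilinear transport of ranges**: for an additive bijection `T` of a `K`-module `W`, τ-semilinear for a ring automorphism `τ` of `K`,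
and `K`-linear `f, g` with `T ∘ f = g ∘ T`, the ranges of `f` and `g` have the same rank (`T` restricts to a τ-semilinear bijection
`range f ≃ range g`). [cite: BourbakiAlgebraI1989, Ch. II §1 no. 13 and §7 no. 2] [cite: Milne2017, Prop. 4.31 and Cor. 4.34] -/
theorem rank_range_eq_of_semiconj (τ : K ≃+* K) (T : W ≃+ W) (hT : ∀ (z : K) (w : W), T (z • w) = τ z • T w)
    (f g : W →ₗ[K] W) (h : ∀ w, T (f w) = g (T w)) :
    Module.rank K (LinearMap.range f) = Module.rank K (LinearMap.range g) := by
  have hmem : ∀ x ∈ LinearMap.range f, T x ∈ LinearMap.range g := by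
    rintro _ ⟨w, rfl⟩
    exact ⟨T w, (h w).symm⟩
  have hmem' : ∀ y ∈ LinearMap.range g, T.symm y ∈ LinearMap.range f := by
    rintro _ ⟨w, rfl⟩
    refine ⟨T.symm w, T.injective ?_⟩
    rw [h, T.apply_symm_apply, T.apply_symm_apply]
  let j : LinearMap.range f ≃+ LinearMap.range g :=
    { toFun := fun x => ⟨T x, hmem x x.2⟩
      invFun := fun y => ⟨T.symm y, hmem' y y.2⟩
      left_inv := fun x => Subtype.ext (T.symm_apply_apply x)
      right_inv := fun y => Subtype.ext (T.apply_symm_apply y)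
      map_add' := fun x y => Subtype.ext (T.map_add x y) }
  exact rank_eq_of_equiv_equiv τ j τ.bijective fun z x => Subtype.ext (hT z x)

/-- `finrank` form of `rank_range_eq_of_semiconj`. [cite: BourbakiAlgebraI1989, Ch. II §1 no. 13 and §7 no. 2] -/
theorem finrank_range_eq_of_semiconj (τ : K ≃+* K) (T : W ≃+ W) (hT : ∀ (z : K) (w : W), T (z • w) = τ z • T w)
    (f g : W →ₗ[K] W) (h : ∀ w, T (f w) = g (T w)) :
    Module.finrank K (LinearMap.range f) = Module.finrank K (LinearMap.range g) :=
  congrArg Cardinal.toNat (rank_range_eq_of_semiconj τ T hT f g h)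

/-- **Constancy on a transitive family**: if any two members of a family of endomorphisms are semilinearly conjugate, all ranges have the
same rank. [cite: BourbakiAlgebraI1989, Ch. II §1 no. 13 and §7 no. 2] -/
theorem rank_range_eq_of_forall_exists_semiconj {I : Type*} (f : I → W →ₗ[K] W)
    (h : ∀ i j : I, ∃ (τ : K ≃+* K) (T : W ≃+ W), (∀ (z : K) (w : W), T (z • w) = τ z • T w) ∧ ∀ w, T (f i w) = f j (T w))
    (i j : I) : Module.rank K (LinearMap.range (f i)) = Module.rank K (LinearMap.range (f j)) := by
  obtain ⟨τ, T, hT, hc⟩ := h i j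
  exact rank_range_eq_of_semiconj τ T hT (f i) (f j) hc

end Semiconj

/-! ## §2 `W = ℂ ⊗_ℚ V`: the maps `τ ⊗ 1` -/

section Complex

variable {V : Type*} [AddCommGroup V] [Module ℚ V]

/-- `(τ ⊗ 1)(z • w) = τ z • (τ ⊗ 1) w`: `τ ⊗ 1` is τ-SEMILINEAR for the complex structure of `ℂ ⊗_ℚ V`.
[cite: Milne2017, Prop. 4.31 and Cor. 4.34] -/
theorem rTensor_aut_smul (τ : ℂ ≃+* ℂ) (z : ℂ) (w : ℂ ⊗[ℚ] V) :
    (τ.toRingHom.toRatAlgHom.toLinearMap.rTensor V) (z • w) = τ z • (τ.toRingHom.toRatAlgHom.toLinearMap.rTensor V) w := by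
  induction w using TensorProduct.induction_on with
  | zero => rw [smul_zero, map_zero, smul_zero]
  | tmul c v =>
    rw [TensorProduct.smul_tmul', rTensor_aut_tmul, rTensor_aut_tmul, TensorProduct.smul_tmul', smul_eq_mul, smul_eq_mul, map_mul]
  | add x y hx hy => rw [smul_add, map_add, map_add, hx, hy, smul_add]

/-- `(τ ⊗ 1) ((τ⁻¹ ⊗ 1) w) = w`. [cite: Milne2017, Prop. 4.31 and Cor. 4.34] -/
theorem rTensor_aut_rTensor_aut_symm (τ : ℂ ≃+* ℂ) (w : ℂ ⊗[ℚ] V) :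
    (τ.toRingHom.toRatAlgHom.toLinearMap.rTensor V) ((τ.symm.toRingHom.toRatAlgHom.toLinearMap.rTensor V) w) = w := by
  induction w using TensorProduct.induction_on with
  | zero => rw [map_zero, map_zero]
  | tmul c v => rw [rTensor_aut_tmul, rTensor_aut_tmul]; exact congrArg (· ⊗ₜ[ℚ] v) (τ.apply_symm_apply c)
  | add x y hx hy => rw [map_add, map_add, hx, hy]

/-- `(τ⁻¹ ⊗ 1) ((τ ⊗ 1) w) = w`. [cite: Milne2017, Prop. 4.31 and Cor. 4.34] -/
theorem rTensor_aut_symm_rTensor_aut (τ : ℂ ≃+* ℂ) (w : ℂ ⊗[ℚ] V) :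
    (τ.symm.toRingHom.toRatAlgHom.toLinearMap.rTensor V) ((τ.toRingHom.toRatAlgHom.toLinearMap.rTensor V) w) = w := by
  simpa using rTensor_aut_rTensor_aut_symm (V := V) τ.symm w

/-- `τ ⊗ 1` is a bijection of `ℂ ⊗_ℚ V`. [cite: Milne2017, Prop. 4.31 and Cor. 4.34] -/
theorem rTensor_aut_bijective (τ : ℂ ≃+* ℂ) : Function.Bijective (τ.toRingHom.toRatAlgHom.toLinearMap.rTensor V) :=
  ⟨fun x y h => by
      have h' := congrArg (τ.symm.toRingHom.toRatAlgHom.toLinearMap.rTensor V) h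
      rwa [rTensor_aut_symm_rTensor_aut, rTensor_aut_symm_rTensor_aut] at h',
    fun w => ⟨_, rTensor_aut_rTensor_aut_symm τ w⟩⟩

/-- **`τ ⊗ 1` commutes with every base-changed rational endomorphism `h ⊗ 1`** (rational endomorphisms are `Aut(ℂ)`-equivariant).
[cite: Milne2017, Prop. 4.31 and Cor. 4.34] -/
theorem rTensor_aut_baseChange (τ : ℂ ≃+* ℂ) (h : V →ₗ[ℚ] V) (w : ℂ ⊗[ℚ] V) :
    (τ.toRingHom.toRatAlgHom.toLinearMap.rTensor V) (h.baseChange ℂ w) = h.baseChange ℂ ((τ.toRingHom.toRatAlgHom.toLinearMap.rTensor V) w) := by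
  induction w using TensorProduct.induction_on with
  | zero => rw [map_zero, map_zero, map_zero]
  | tmul c v => rw [LinearMap.baseChange_tmul, rTensor_aut_tmul, rTensor_aut_tmul, LinearMap.baseChange_tmul]
  | add x y hx hy => rw [map_add, map_add, map_add, hx, hy, map_add]

/-- **(B-orbit) ENGINE on `ℂ ⊗_ℚ V`**: if two `ℂ`-linear endomorphisms `f, g` of `ℂ ⊗_ℚ V` are conjugate under `τ ⊗ 1` (`(τ⊗1) ∘ f = g ∘ (τ⊗1)`),
their ranges have the same `finrank` — e.g. the blocks `e_σ(ℂ ⊗ V)`, `e_{σ′}(ℂ ⊗ V)` of two `Aut(ℂ)`-conjugate idempotents of `ℂ ⊗ End_ℚ V`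
(conjugacy from `rTensor_aut_smul` + `rTensor_aut_baseChange`; transitivity of the orbit from ★ (G4)).
[cite: BourbakiAlgebraI1989, Ch. II §1 no. 13 and §7 no. 2] [cite: Milne2017, Prop. 4.31 and Cor. 4.34] -/
theorem finrank_range_eq_of_rTensor_aut_conj (τ : ℂ ≃+* ℂ) (f g : ℂ ⊗[ℚ] V →ₗ[ℂ] ℂ ⊗[ℚ] V)
    (h : ∀ w, (τ.toRingHom.toRatAlgHom.toLinearMap.rTensor V) (f w) = g ((τ.toRingHom.toRatAlgHom.toLinearMap.rTensor V) w)) :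
    Module.finrank ℂ (LinearMap.range f) = Module.finrank ℂ (LinearMap.range g) := by
  let T : ℂ ⊗[ℚ] V ≃+ ℂ ⊗[ℚ] V :=
    { toFun := τ.toRingHom.toRatAlgHom.toLinearMap.rTensor V
      invFun := τ.symm.toRingHom.toRatAlgHom.toLinearMap.rTensor V
      left_inv := rTensor_aut_symm_rTensor_aut τ
      right_inv := rTensor_aut_rTensor_aut_symm τ
      map_add' := map_add _ }
  exact finrank_range_eq_of_semiconj τ T (fun z w => rTensor_aut_smul τ z w) f g h

/-- `rank` form of the engine. [cite: BourbakiAlgebraI1989, Ch. II §1 no. 13 and §7 no. 2] -/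
theorem rank_range_eq_of_rTensor_aut_conj (τ : ℂ ≃+* ℂ) (f g : ℂ ⊗[ℚ] V →ₗ[ℂ] ℂ ⊗[ℚ] V)
    (h : ∀ w, (τ.toRingHom.toRatAlgHom.toLinearMap.rTensor V) (f w) = g ((τ.toRingHom.toRatAlgHom.toLinearMap.rTensor V) w)) :
    Module.rank ℂ (LinearMap.range f) = Module.rank ℂ (LinearMap.range g) := by
  let T : ℂ ⊗[ℚ] V ≃+ ℂ ⊗[ℚ] V :=
    { toFun := τ.toRingHom.toRatAlgHom.toLinearMap.rTensor V
      invFun := τ.symm.toRingHom.toRatAlgHom.toLinearMap.rTensor V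
      left_inv := rTensor_aut_symm_rTensor_aut τ
      right_inv := rTensor_aut_rTensor_aut_symm τ
      map_add' := map_add _ }
  exact rank_range_eq_of_semiconj τ T (fun z w => rTensor_aut_smul τ z w) f g h

end Complex

end Literature.LinearAlgebra.BaseChange
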